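import Mathlib
import HarnessLib
import Summits.HubbardSuperconductivity.HubbardSuperconductivity.Theorems.KLProgrammeKLRegimeEngineTowerWtAssemblyKlEngClosedSharp3
import Summits.HubbardSuperconductivity.HubbardSuperconductivity.Theorems.KLProgrammeKLRegimeEngineTowerWtAssemblyKlEngFinal
import Summits.HubbardSuperconductivity.HubbardSuperconductivity.Theorems.KLProgrammeKLRegimeEngineScaleOneDatumWtKlEng

/-!
# ♯3 RE-KEY («E-b1-2LEG-SHAPE», pen (R403)): the main tower's two-leg import amplitude `ι₁ : ℕ → ℝ` is RATE-INDEXED and the two-leg plain line is asked in the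
# λ-FREE c-class shape `S₂·4^{−(dk−1)}` (k3c2-p3's binders glue fed with `s₂ := S₂/λ_j`); the ♯ (sharp bracket) and ♯2 (block 0 once at `λ_d`) cures are kept.
# ♯ RE-KEY («(b)-WT4-READOUT-CE-DIM», located by p4 g22 l.≈11700): the read-out bracket is the SHARP one (`readoutBracket_le_law_mul_sharp`): the `y`-term of `A_tot`
# is divided by `2τQ″` instead of multiplied by `ψ` (ratio `2τψQ″ ∝ (M/β)²`), so `A_tot/ε_x` is `O(1)` in `M/β` and the CE row is M-UNIFORM; nothing else changes.
# Route `KLProgramme` — crux K3 ENGINE (stmt-HubbardSuperconductivity-20437 `KLRegimeEngineV17F2`), stub (b) v2, THE WEIGHTED HALF «(b)-WT4»: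
# W14 — «(b)-WT4-ASSEMBLY-∀j», FINAL FORM: the weighted clause at EVERY level modulo STRUCTURAL E1 INPUTS, NUMERICS AND CAPS — NO KIT-CURRENCY ROW
# (cell gate-hubbard-kl, seat hubbard-kl-k3c3-p2 g17; W12 `kernelNormsWt4_all_klEng_closed` (p704715) with every block-0 DATA row discharged by W13
#  `exists_levelZeroDatumWt_klEng` (weighted, every rate) and p3 g22's `exists_levelZeroDatum_klEng` (plain, for the Z-thread's guard); E1 may rename or supersede)

W12's level-0 rows in kit currency — the weighted unit law of `𝒱_1[K_n]` at `(F_0, rate j)`, the two groups of Chernoff/import rows of the arrays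
`W_g·Z_g^m·klTowerMeasWtAt … 1 1 j (2m)/klLevUnitF β M 0 m 0`, the two block-0 kit guards, and the Z-thread's PLAIN guard on `klTowerMuLevF … 1 1 m` — are ALL
discharged: the unit law by W13 (so `A_b₀ = A₁ε_x/Klam²/B²`, `Q_b₀ = P₁/ε_x²` become NAMES), the Chernoff rows `m ≥ 3` by the DOMINATIONS `W_g·A_b₀ ≤ A′_g`,
`Z_g·Q_b₀ ≤ Q′_g`, `W_g·Z_g³·A_b₀·Q_b₀³ ≤ ι₃g`, the import rows `m = 1, 2` by W13's degree-2/4 budgets (`W_g·Z_g·T₁(|U|+c)/ε_x ≤ ι₁g·λ_j`,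
`W_g·Z_g²·A₁P₁²|U|/ε_x³ ≤ ι₂g·λ_j`), and the three guards by guards on MAJORANT ARRAYS `ν_g j`, `ν_z` (free binders with explicit domination rows) through
`towerV_mono_Icc` (§1: `towerV D τ μ = Σ_{m∈[1,D]} (eτ)^m μ m` is monotone in the array on `[1, D]`) and `kitRowsWt_of_unitLaw` (§1, pure real algebra).
* **`kernelNormsWt4_all_klEng_final (d R c″)`** ⊢ `∀ j ≤ n, KernelNormsWt4 L M (klWtBudget P Qe U j) β U μ (klFlowFrameU L M β U μ n) j`.
INPUT CLASSES after this file (exhaustive): [E1 structural] the `klScaleWt_j`-weighted PLAIN two-, four- and six-leg pinned lines of the imports (`s₂ s₄ s₆`, blocks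
`d·k ≤ j`, rates `d ≤ j ≤ n`) and of the cells (`S₄` at `1 ≤ j ≤ n`, `S₆` at `d ≤ j ≤ n`), blocking `d ≥ 2`, `B ≥ 1`; [numerics, p4] the doors
(`c ≤ klEngC₃6 ⊓ c₃′ ⊓ c₀`, `U ≤ klEngU₀9 ⊓ U₀′ ⊓ U₁`, `c″U ≤ 1`), dominants `κb αb crb ccb` (8 inequalities), names `W Z σ τ ψ Φ`, `A′ Q″` (4 dominations, `0 < Q″`),
the 8 kit rows at every `λ_j` (`d ≤ j ≤ n`), `Atot Qtot` (equational) + CE row, `(klEngQ7 P R).IsRaiseOf Qe`; block 0: names `Ab₀ Qb₀` and two name groups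
(equational), `A′_g ≥ 0, Q′_g > 0, ι_g`, three dominations per group, majorant arrays `ν₀ ν₁` (three domination rows each) and `ν_z` (three rows), per-rate bundles
(two budget rows, five smallness rows, one guard) at `d ≤ j ≤ n` (group 0) and `1 ≤ j ≤ d−1` (group 1), the Z-thread names + guard (under `d ≤ n`), read-out names
`Aro Qro Qtot Atot` ×2 (equational) + two CE rows, `Atot₁ j ≤ Ab` (`d ≤ j ≤ n`), `Qtot₁ = Qb`, cell thresholds; [D] `D ≥ 3` and the three caps.
Bookkeeping composition of landed theorems and real algebra; nothing asserts (b), WT4's rows, (ℓ), any stub, K3 or superconductivity.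
References: BGM 2006 §2.3 (2.13)–(2.14), §2.7 (2.71a), (2.77)–(2.81), §2.8 (2.76)–(2.84), (2.93)–(2.98), Lemma 2.5, §3 (3.2)–(3.8) [cite: BenfattoGiulianiMastropietro2006].
-/

noncomputable section

namespace Summit.HubbardSuperconductivity.HubbardSuperconductivity.Theorems.EngineV8

set_option linter.dupNamespace false -- summit = problem name (single-conjunct summit), D-0017

open Classical
open Real Finset Literature.MathematicalPhysics.QuantumLattice Literature.Probability.LatticeModels GrassmannAlgebra
open Literature.MathematicalPhysics.QuantumLattice.FermiRG Literature.MathematicalPhysics.QuantumLattice.FermiRG.BGM2006Routing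
open Summit.HubbardSuperconductivity.HubbardSuperconductivity.Theorems.KLProgrammeLegKernels
open Summit.HubbardSuperconductivity.HubbardSuperconductivity.Theorems.KLRegimeSplit
open Summit.HubbardSuperconductivity.HubbardSuperconductivity.Theorems.KLRegimeWick
open Summit.HubbardSuperconductivity.HubbardSuperconductivity.Theorems.TwoPointAssembly
open Summit.HubbardSuperconductivity.HubbardSuperconductivity.Theorems.DispersionFlow
open Summit.HubbardSuperconductivity.HubbardSuperconductivity.Theorems.TorusFourierL2

variable {L M : ℕ} [NeZero L] [NeZero M]



/-! ## §2 The weighted clause at every level, modulo structural E1 inputs, numerics and caps — no kit-currency row -/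

set_option maxHeartbeats 400000 in -- two ~60-binder kit bundles instantiated inside one ~250-binder composition (default × 2)
/-- **STUB (b)'s WEIGHTED CLAUSE ON THE FLOW FRAME — EVERY LEVEL, MODULO STRUCTURAL E1 INPUTS, NUMERICS AND CAPS, NO KIT-CURRENCY ROW** (W12 ∘ W13 ∘ p3's
plain datum; see the module docstring for the exhaustive input list); conclusion `∀ j ≤ n, KernelNormsWt4 L M (klWtBudget P Qe U j) β U μ (klFlowFrameU L M β U μ n) j`.
[cite: BenfattoGiulianiMastropietro2006, §2.3 (2.13)-(2.14), §2.7 (2.71a), (2.77)-(2.81), §2.8 (2.76)-(2.84), (2.93)-(2.98), Lemma 2.5 (2.98), §3 (3.2)-(3.8)] -/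
theorem kernelNormsWt4_all_klEng_final_sharp3 (d : ℕ) (R : RenConsts) (c'' : ℝ) (hc'' : 0 < c'') :
    ∃ C₁ C₂ Cκ Cb CJ C₁r C₂r Cκr Cbr CJr C₁i C₂i : ℝ, 0 < C₁ ∧ 0 < C₂ ∧ 0 < Cκ ∧ 0 < Cb ∧ 0 < CJ ∧
      0 < C₁r ∧ 0 < C₂r ∧ 0 < Cκr ∧ 0 < Cbr ∧ 0 < CJr ∧ 0 < C₁i ∧ 0 < C₂i ∧
      ∃ Cinc₁ Dinc₁ : ℝ, 1 ≤ Cinc₁ ∧ 1 ≤ Dinc₁ ∧ ∃ Cκ₀ CJ₀ Cα : ℝ, 0 < Cκ₀ ∧ 0 < CJ₀ ∧ 0 < Cα ∧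
      ∃ Cκz Cbz CJz : ℝ, 0 < Cκz ∧ 0 < Cbz ∧ 0 < CJz ∧ ∃ CWi CW₄ CW₆ : ℝ, 0 < CWi ∧ 0 < CW₄ ∧ 0 < CW₆ ∧
      ∃ Cinc₂ Dinc₂ : ℝ, 1 ≤ Cinc₂ ∧ 1 ≤ Dinc₂ ∧ ∃ Cκ₁ CJ₁ Cα₁ : ℝ, 0 < Cκ₁ ∧ 0 < CJ₁ ∧ 0 < Cα₁ ∧
      (R.WF2 → ∃ c₃' : ℝ, 0 < c₃' ∧ ∃ U₀' : ℝ, 0 < U₀' ∧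
      ∀ P : SplitConsts, P.WF → ∃ A₁ P₁ T₁ A₁' P₁' T₁' : ℝ, 0 < A₁ ∧ 0 < P₁ ∧ 0 < T₁ ∧ 0 < A₁' ∧ 0 < P₁' ∧ 0 < T₁' ∧
      ∃ c₀ : ℝ, 0 < c₀ ∧ ∃ U₁ : ℝ, 0 < U₁ ∧
      ∀ (G : GeoConsts) (Q : EngConsts) (c : ℝ), 0 < c → c ≤ klEngC₃6 P R → c ≤ c₃' → c ≤ c₀ →
      ∀ μ ∈ klWindowC, ∀ U : ℝ, 0 < U → U ≤ klEngU₀9 P R c → U ≤ U₀' → U ≤ U₁ → c'' * U ≤ 1 →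
      ∀ β : ℝ, klBetaMin ≤ β → β ≤ Real.exp (c / U ^ 2) →
      ∀ (L M : ℕ) [NeZero L] [NeZero M], klEngL₃ β U ≤ L → klEngM₃ β U L ≤ M →
      ∀ n : ℕ, 1 ≤ n → n ≤ nScales β + 1 → IsKLRegime U c (-(n : ℤ)) → HistP klPredsV17F2 L M G P Q R β U μ 0 n →
        (∀ m', 1 ≤ m' → m' < n → FlowPieceOscAt L M c'' β U μ m') →
      2 ≤ d →
      -- the degree caps [choice: `exists_degreeCap`] (+ block `0`'s input family `F_0`)
      ∀ D : ℕ, 3 ≤ D → (∀ k, 1 ≤ k → d * k ≤ n → Fintype.card (SpaceTimeIdx L M × SectorLeg (sectorCount (d * k - 1))) / 2 ≤ D) →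
        Fintype.card (HubbardFieldIdx L M) ≤ 2 * D + 1 → Fintype.card (SpaceTimeIdx L M × SectorLeg (sectorCount 0)) / 2 ≤ D →
      -- the coupling amplitude and the law's constants
      ∀ (B A Q' Ab Qb : ℝ), 1 ≤ B → 0 ≤ A → 0 < Q' → 0 ≤ Ab → 0 ≤ Qb →
      -- THE LEVEL-0 WEIGHTED DATUM'S AMPLITUDE NAMES (W13, equational); BLOCK 0's BASE LAW (p3 WB3): names (group 0), dominations, majorant array, numerics ONCE at `λ_d` (under `d ≤ n`)
      ∀ (Ab₀ Qb₀ : ℝ), Ab₀ = A₁ * imagTimeWeight β M / P.Klam ^ 2 / B ^ 2 → Qb₀ = P₁ / imagTimeWeight β M ^ 2 →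
      ∀ (αb₀ κb₀ crb₀ ccb₀ W₀ Z₀ σ₀ τ₀ ψ₀ Φ₀ : ℝ), αb₀ = Cα * ((M : ℝ) / β) → κb₀ = Real.sqrt (2 * Cκ₀ * klE0) → crb₀ = 81 * CJ₀ * M / β →
        ccb₀ = 162 * CJ₀ * M / β → W₀ = 32 * crb₀ / ccb₀ → Z₀ = imagTimeWeight β M ^ 2 * ccb₀ ^ 2 / 8 → σ₀ = κb₀ ^ 2 / ccb₀ ^ 2 →
        τ₀ = 4 * exp 4 * κb₀ ^ 2 / ccb₀ ^ 2 → ψ₀ = ccb₀ ^ 2 / κb₀ ^ 2 → Φ₀ = exp 1 * αb₀ * ccb₀ / (κb₀ ^ 2 * crb₀) →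
      ∀ (A'₀ Q'₀ ι₁₀ ι₂₀ ι₃₀ : ℝ), 0 ≤ A'₀ → 0 < Q'₀ →
      W₀ * Ab₀ ≤ A'₀ → Z₀ * Qb₀ ≤ Q'₀ → W₀ * Z₀ ^ 3 * Ab₀ * Qb₀ ^ 3 ≤ ι₃₀ →
      ∀ ν₀ : ℕ → ℝ, (∀ m, 3 ≤ m → W₀ * Z₀ ^ m * (Ab₀ * (B * epsCoupling P U d) ^ (m - 1) * Qb₀ ^ m) ≤ ν₀ m) →
        W₀ * Z₀ ^ 1 * (T₁ * (|U| + c) / imagTimeWeight β M) ≤ ν₀ 1 →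
        W₀ * Z₀ ^ 2 * (A₁ * P₁ ^ 2 * |U| / imagTimeWeight β M ^ 3) ≤ ν₀ 2 →
      (d ≤ n →
        W₀ * Z₀ ^ 1 * (T₁ * (|U| + c) / imagTimeWeight β M) ≤ ι₁₀ * (B * epsCoupling P U d) ∧
        W₀ * Z₀ ^ 2 * (A₁ * P₁ ^ 2 * |U| / imagTimeWeight β M ^ 3) ≤ ι₂₀ * (B * epsCoupling P U d) ∧
        4 * σ₀ * (B * epsCoupling P U d) * Q'₀ < 1 ∧ 2 * (B * epsCoupling P U d) * τ₀ * Q'₀ ≤ 1 ∧ exp 1 * τ₀ * (B * epsCoupling P U d) * Q'₀ < 1 ∧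
        Φ₀ * (τ₀ * (ι₁₀ * (B * epsCoupling P U d) + ι₂₀ / (2 * Q'₀) + ι₃₀ / (4 * Q'₀ ^ 2) + A'₀ * Q'₀ / 4)) < 1 ∧
        Φ₀ * (exp 1 * τ₀ * (ι₁₀ * (B * epsCoupling P U d)) + (exp 1 * τ₀) ^ 2 * (ι₂₀ * (B * epsCoupling P U d)) +
          (exp 1 * τ₀) ^ 3 * (ι₃₀ * (B * epsCoupling P U d) ^ 2) +
          A'₀ * (exp 1 * τ₀ * Q'₀) * ((exp 1 * τ₀ * (B * epsCoupling P U d) * Q'₀) ^ 3 / (1 - exp 1 * τ₀ * (B * epsCoupling P U d) * Q'₀))) < 1 ∧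
        Φ₀ * towerV D τ₀ ν₀ < 1) →
      ∀ (Aro₁ Qro₁ Qtot₁ Atot₁ : ℝ), Aro₁ = Cinc₁ * Ab₀ → Qro₁ = Dinc₁ * Qb₀ →
        Qtot₁ = Dinc₁ * max 1 (max Qro₁ (max (4 * Q'₀) (2 * τ₀ * ψ₀ * Q'₀))) →
        (Atot₁ = Aro₁ + Cinc₁ * (A'₀ * (4 * σ₀ * (B * epsCoupling P U d) * Q'₀ / (1 - 4 * σ₀ * (B * epsCoupling P U d) * Q'₀)) +
          exp 1 * (τ₀ * (ι₁₀ * (B * epsCoupling P U d) + ι₂₀ / (2 * Q'₀) + ι₃₀ / (4 * Q'₀ ^ 2) + A'₀ * Q'₀ / 4)) *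
            (Φ₀ * (τ₀ * (ι₁₀ * (B * epsCoupling P U d) + ι₂₀ / (2 * Q'₀) + ι₃₀ / (4 * Q'₀ ^ 2) + A'₀ * Q'₀ / 4)) /
              (1 - Φ₀ * (τ₀ * (ι₁₀ * (B * epsCoupling P U d) + ι₂₀ / (2 * Q'₀) + ι₃₀ / (4 * Q'₀ ^ 2) + A'₀ * Q'₀ / 4)))) / (2 * τ₀ * Q'₀))) →
        (d ≤ n → Atot₁ ≤ Ab) → Qtot₁ = Qb →
      -- BLOCK 0's Z-THREAD (p3 `towerZ_blockZero_klEng`): its four names, a majorant array of the PLAIN level-0 datum (p3's `exists_levelZeroDatum_klEng`, at `λ_1`)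
      -- and the PLAIN kit guard on it [numerics; read only when `d ≤ n`]
      ∀ (κz αz crz ccz : ℝ), κz = Real.sqrt (2 * Cκz * klE0) → αz = Cbz * ((M : ℝ) / β) * (4 : ℝ) ^ d / klE0 →
        crz = 81 * CJz * M / β → ccz = 162 * CJz * M / β →
      ∀ νz : ℕ → ℝ, (27 : ℝ) ^ 5 * (T₁' * (|U| + c) / imagTimeWeight β M) ≤ νz 1 → (27 : ℝ) ^ 5 * (A₁' * P₁' ^ 2 * |U| / imagTimeWeight β M ^ 3) ≤ νz 2 →
        (∀ m, 3 ≤ m → (27 : ℝ) ^ 5 * (A₁' * imagTimeWeight β M / P.Klam ^ 2 / B ^ 2) * (B * epsCoupling P U 1) ^ (m - 1) * (P₁' / imagTimeWeight β M ^ 2) ^ m ≤ νz m) →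
      (d ≤ n → 9 * αz * ccz / ((27 : ℝ) ^ 5 * exp 1 * κz ^ 2 * crz) *
        towerV D (exp 2 * κz ^ 2 / ccz ^ 2)
          (fun m => 64 * (27 : ℝ) ^ 4 * exp 2 * crz / ccz * (exp 4 * ccz ^ 2 * imagTimeWeight β M ^ 2 / 8) ^ m * νz m) < 1) →
      -- BLOCK 0's LEVELS `1 ≤ j < d` (W11b at `d−1`): names (group 1, equational), dominations, majorant array, numerics at `λ_j`, `1 ≤ j ≤ d − 1`
      ∀ (αb₁ κb₁ crb₁ ccb₁ W₁ Z₁ σ₁ τ₁ ψ₁ Φ₁ : ℝ), αb₁ = Cα₁ * ((M : ℝ) / β) → κb₁ = Real.sqrt (2 * Cκ₁ * klE0) → crb₁ = 81 * CJ₁ * M / β →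
        ccb₁ = 162 * CJ₁ * M / β → W₁ = 32 * crb₁ / ccb₁ → Z₁ = imagTimeWeight β M ^ 2 * ccb₁ ^ 2 / 8 → σ₁ = κb₁ ^ 2 / ccb₁ ^ 2 →
        τ₁ = 4 * exp 4 * κb₁ ^ 2 / ccb₁ ^ 2 → ψ₁ = ccb₁ ^ 2 / κb₁ ^ 2 → Φ₁ = exp 1 * αb₁ * ccb₁ / (κb₁ ^ 2 * crb₁) →
      ∀ (A'₁ Q'₁ ι₁₁ ι₂₁ ι₃₁ : ℝ), 0 ≤ A'₁ → 0 < Q'₁ →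
      W₁ * Ab₀ ≤ A'₁ → Z₁ * Qb₀ ≤ Q'₁ → W₁ * Z₁ ^ 3 * Ab₀ * Qb₀ ^ 3 ≤ ι₃₁ →
      ∀ ν₁ : ℕ → ℕ → ℝ, (∀ j m, 3 ≤ m → W₁ * Z₁ ^ m * (Ab₀ * (B * epsCoupling P U j) ^ (m - 1) * Qb₀ ^ m) ≤ ν₁ j m) →
        (∀ j, W₁ * Z₁ ^ 1 * (T₁ * (|U| + c) / imagTimeWeight β M) ≤ ν₁ j 1) →
        (∀ j, W₁ * Z₁ ^ 2 * (A₁ * P₁ ^ 2 * |U| / imagTimeWeight β M ^ 3) ≤ ν₁ j 2) →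
      (∀ j, 1 ≤ j → j ≤ d - 1 → j ≤ n →
        W₁ * Z₁ ^ 1 * (T₁ * (|U| + c) / imagTimeWeight β M) ≤ ι₁₁ * (B * epsCoupling P U j) ∧
        W₁ * Z₁ ^ 2 * (A₁ * P₁ ^ 2 * |U| / imagTimeWeight β M ^ 3) ≤ ι₂₁ * (B * epsCoupling P U j) ∧
        4 * σ₁ * (B * epsCoupling P U j) * Q'₁ < 1 ∧ 2 * (B * epsCoupling P U j) * τ₁ * Q'₁ ≤ 1 ∧ exp 1 * τ₁ * (B * epsCoupling P U j) * Q'₁ < 1 ∧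
        Φ₁ * (τ₁ * (ι₁₁ * (B * epsCoupling P U j) + ι₂₁ / (2 * Q'₁) + ι₃₁ / (4 * Q'₁ ^ 2) + A'₁ * Q'₁ / 4)) < 1 ∧
        Φ₁ * (exp 1 * τ₁ * (ι₁₁ * (B * epsCoupling P U j)) + (exp 1 * τ₁) ^ 2 * (ι₂₁ * (B * epsCoupling P U j)) +
          (exp 1 * τ₁) ^ 3 * (ι₃₁ * (B * epsCoupling P U j) ^ 2) +
          A'₁ * (exp 1 * τ₁ * Q'₁) * ((exp 1 * τ₁ * (B * epsCoupling P U j) * Q'₁) ^ 3 / (1 - exp 1 * τ₁ * (B * epsCoupling P U j) * Q'₁))) < 1 ∧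
        Φ₁ * towerV D τ₁ (ν₁ j) < 1) →
      ∀ (Aro₂ Qro₂ Qtot₂ : ℝ) (Atot₂ : ℕ → ℝ), Aro₂ = Cinc₂ * Ab₀ → Qro₂ = Dinc₂ * Qb₀ →
        Qtot₂ = Dinc₂ * max 1 (max Qro₂ (max (4 * Q'₁) (2 * τ₁ * ψ₁ * Q'₁))) →
        (∀ j, Atot₂ j = Aro₂ + Cinc₂ * (A'₁ * (4 * σ₁ * (B * epsCoupling P U j) * Q'₁ / (1 - 4 * σ₁ * (B * epsCoupling P U j) * Q'₁)) +
          exp 1 * (τ₁ * (ι₁₁ * (B * epsCoupling P U j) + ι₂₁ / (2 * Q'₁) + ι₃₁ / (4 * Q'₁ ^ 2) + A'₁ * Q'₁ / 4)) *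
            (Φ₁ * (τ₁ * (ι₁₁ * (B * epsCoupling P U j) + ι₂₁ / (2 * Q'₁) + ι₃₁ / (4 * Q'₁ ^ 2) + A'₁ * Q'₁ / 4)) /
              (1 - Φ₁ * (τ₁ * (ι₁₁ * (B * epsCoupling P U j) + ι₂₁ / (2 * Q'₁) + ι₃₁ / (4 * Q'₁ ^ 2) + A'₁ * Q'₁ / 4)))) / (2 * τ₁ * Q'₁))) →
      -- dominants of the LINK's and of the read-out's constants, and the names
      ∀ (κb αb crb ccb : ℝ), Real.sqrt (2 * Cκ * klE0) ≤ κb → Cb * ((M : ℝ) / β) * (4 : ℝ) ^ d / klE0 ≤ αb →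
        81 * CJ * M / β ≤ crb → 162 * CJ * M / β ≤ ccb →
        Real.sqrt (2 * Cκr * klE0) ≤ κb → Cbr * ((M : ℝ) / β) * (4 : ℝ) ^ d / klE0 ≤ αb → 81 * CJr * M / β ≤ crb → 162 * CJr * M / β ≤ ccb →
      ∀ (W Z σ τ ψ Φ : ℝ),
        W = 32 * crb / ccb → Z = imagTimeWeight β M ^ 2 * ccb ^ 2 / 8 →
        σ = κb ^ 2 / ccb ^ 2 → τ = 4 * exp 4 * κb ^ 2 / ccb ^ 2 → ψ = ccb ^ 2 / κb ^ 2 → Φ = exp 1 * αb * ccb / (κb ^ 2 * crb) →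
      ∀ (A' Q'' : ℝ),
        W * ((C₁ / C₂) * (8 : ℝ) ^ (d - 1) * (Ab + A / (1 - ((2 : ℝ) ^ d)⁻¹))) ≤ A' →
        Z * (C₂ ^ 2 * ((2 : ℝ) ^ (d - 1))⁻¹ * max Q' Qb) ≤ Q'' → W * Ab ≤ A' → Z * Qb ≤ Q'' → 0 < Q'' →
      -- the weighted IMPORTS: `klScaleWt_j`-weighted PLAIN two-, four- and six-leg pinned lines of `𝒱_{dk}[K_n]`, every block `d·k ≤ j`, every rate `d ≤ j ≤ n` [E1]
      ∀ (S₂ s₄ s₆ : ℝ), 0 ≤ S₂ → 0 ≤ s₄ → 0 ≤ s₆ →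
      (∀ j, d ≤ j → j ≤ n → ∀ k, 1 ≤ k → d * k ≤ j → ∀ (q : Fin 2) (τ' : Fin 2 → SectorLeg 1) (y' : SpaceTimeIdx L M),
        imagTimeWeight β M ^ 1 * ∑ x' ∈ univ.filter (fun x' : Fin 2 → SpaceTimeIdx L M => x' q = y'),
          klScaleWt L M β j ((univ.image x').image (fun x : SpaceTimeIdx L M => (((((2 * (x.1 : ℕ) : ℕ)) : ZMod (2 * (2 * M)))), x.2))) *
            ‖sectorisedKernel L M β (trivialMultiplier L M) (klTowerInput L M β U μ (klFlowFrameU L M β U μ n) d k) 2 τ' x'‖ ≤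
          S₂ * ((4 : ℝ) ^ (d * k - 1))⁻¹) →
      (∀ j, d ≤ j → j ≤ n → ∀ k, 1 ≤ k → d * k ≤ j → ∀ (q : Fin 4) (τ' : Fin 4 → SectorLeg 1) (y' : SpaceTimeIdx L M),
        imagTimeWeight β M ^ 3 * ∑ x' ∈ univ.filter (fun x' : Fin 4 → SpaceTimeIdx L M => x' q = y'),
          klScaleWt L M β j ((univ.image x').image (fun x : SpaceTimeIdx L M => (((((2 * (x.1 : ℕ) : ℕ)) : ZMod (2 * (2 * M)))), x.2))) *
            ‖sectorisedKernel L M β (trivialMultiplier L M) (klTowerInput L M β U μ (klFlowFrameU L M β U μ n) d k) 4 τ' x'‖ ≤ s₄ * (B * epsCoupling P U j)) →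
      (∀ j, d ≤ j → j ≤ n → ∀ k, 1 ≤ k → d * k ≤ j → ∀ (q : Fin 6) (τ' : Fin 6 → SectorLeg 1) (y' : SpaceTimeIdx L M),
        imagTimeWeight β M ^ 5 * ∑ x' ∈ univ.filter (fun x' : Fin 6 → SpaceTimeIdx L M => x' q = y'),
          klScaleWt L M β j ((univ.image x').image (fun x : SpaceTimeIdx L M => (((((2 * (x.1 : ℕ) : ℕ)) : ZMod (2 * (2 * M)))), x.2))) *
            ‖sectorisedKernel L M β (trivialMultiplier L M) (klTowerInput L M β U μ (klFlowFrameU L M β U μ n) d k) 6 τ' x'‖ ≤ s₆ * (B * epsCoupling P U j) ^ 2) →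
      -- the import amplitudes they induce (equational binders, k3c2-p3's `importBindersWt_of_wplainLines_flow_all`)
      ∀ (i₁ ι₁ : ℕ → ℝ) (i₂ x₆ ι₂ ι₃ : ℝ), (∀ j, i₁ j = 2 * W * Z * klThinCount2C * CWi ^ 2 * (S₂ / (B * epsCoupling P U j))) →
        i₂ = 16 * W * Z ^ 2 * klThinCountC * CWi ^ 4 * s₄ → x₆ = 131072 * W * Z ^ 3 * klThinCount6C * CWi ^ 6 * s₆ →
        (∀ j, ι₁ j = i₁ j * ((M : ℝ) / β)) → ι₂ = i₂ * ((M : ℝ) / β) ^ 3 → ι₃ = x₆ * ((M : ℝ) / β) ^ 5 →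
      -- the kit's numerics at every read-out rate [p4 «part 4»]
      (∀ j, d ≤ j → j ≤ n →
        4 * σ * (B * epsCoupling P U j) * Q'' < 1 ∧ 2 * (B * epsCoupling P U j) * τ * Q'' ≤ 1 ∧ exp 1 * τ * (B * epsCoupling P U j) * Q'' < 1 ∧
        Φ * (τ * (ι₁ j * (B * epsCoupling P U j) + ι₂ / (2 * Q'') + ι₃ / (4 * Q'' ^ 2) + A' * Q'' / 4)) < 1 ∧
        Φ * (exp 1 * τ * (ι₁ j * (B * epsCoupling P U j)) + (exp 1 * τ) ^ 2 * (ι₂ * (B * epsCoupling P U j)) +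
          (exp 1 * τ) ^ 3 * (ι₃ * (B * epsCoupling P U j) ^ 2) +
          A' * (exp 1 * τ * Q'') * ((exp 1 * τ * (B * epsCoupling P U j) * Q'') ^ 3 / (1 - exp 1 * τ * (B * epsCoupling P U j) * Q''))) < 1 ∧
        4 * Q'' ≤ Q' ∧ 2 * τ * ψ * Q'' ≤ Q' ∧
        A' * (4 * Q'') ^ 3 * (4 * σ * (B * epsCoupling P U j) * Q'' / (1 - 4 * σ * (B * epsCoupling P U j) * Q'')) +
          exp 1 * ψ * (2 * τ * ψ * Q'') ^ 2 * (τ * (ι₁ j * (B * epsCoupling P U j) + ι₂ / (2 * Q'') + ι₃ / (4 * Q'' ^ 2) + A' * Q'' / 4)) *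
            (Φ * (τ * (ι₁ j * (B * epsCoupling P U j) + ι₂ / (2 * Q'') + ι₃ / (4 * Q'' ^ 2) + A' * Q'' / 4)) /
              (1 - Φ * (τ * (ι₁ j * (B * epsCoupling P U j) + ι₂ / (2 * Q'') + ι₃ / (4 * Q'' ^ 2) + A' * Q'' / 4)))) ≤ A * Q' ^ 3) →
      -- the read-out constants level by level and the budget package's `CE` row [p4]
      ∀ (Qe : EngConsts) (Atot Qtot : ℕ → ℝ),
        (∀ j, Qtot j = max 1 (C₂i ^ 2) * max 1 (max (C₂r ^ 2 * max Q' Qb) (max (4 * Q'') (2 * τ * ψ * Q'')))) →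
        (∀ j, Atot j = C₁r / C₂r * (Ab + A) + C₁i / C₂i * (A' * (4 * σ * (B * epsCoupling P U j) * Q'' / (1 - 4 * σ * (B * epsCoupling P U j) * Q'')) +
          exp 1 * (τ * (ι₁ j * (B * epsCoupling P U j) + ι₂ / (2 * Q'') + ι₃ / (4 * Q'' ^ 2) + A' * Q'' / 4)) *
            (Φ * (τ * (ι₁ j * (B * epsCoupling P U j) + ι₂ / (2 * Q'') + ι₃ / (4 * Q'' ^ 2) + A' * Q'' / 4)) /
              (1 - Φ * (τ * (ι₁ j * (B * epsCoupling P U j) + ι₂ / (2 * Q'') + ι₃ / (4 * Q'' ^ 2) + A' * Q'' / 4)))) / (2 * τ * Q''))) →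
        (∀ j, d ≤ j → j ≤ n → Qtot j * imagTimeWeight β M ^ 2 * B * max 1 (Atot j / imagTimeWeight β M) ≤ Qe.CE) →
        (∀ j, 1 ≤ j → j ≤ d - 1 → j ≤ n → Qtot₂ * imagTimeWeight β M ^ 2 * B * max 1 (Atot₂ j / imagTimeWeight β M) ≤ Qe.CE) →
        (klEngQ7 P R).IsRaiseOf Qe →
      -- the import CELLS: `m = 4` at every `1 ≤ j ≤ n`, `m = 6` at `d ≤ j ≤ n` — weighted PLAIN four- and six-leg pinned lines of `𝒱_j[K_n]` at `(F_j, rate j)` [E1] + thresholds [numerics]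
      ∀ (S₄ S₆ : ℕ → ℝ), (∀ j, 0 ≤ S₄ j) → (∀ j, 0 ≤ S₆ j) →
      (∀ j, 1 ≤ j → j ≤ n → ∀ (q : Fin 4) (τ' : Fin 4 → SectorLeg 1) (y' : SpaceTimeIdx L M),
        imagTimeWeight β M ^ 3 * ∑ x' ∈ univ.filter (fun x' : Fin 4 → SpaceTimeIdx L M => x' q = y'),
          klScaleWt L M β j ((univ.image x').image (fun x : SpaceTimeIdx L M => (((((2 * (x.1 : ℕ) : ℕ)) : ZMod (2 * (2 * M)))), x.2))) *
            ‖sectorisedKernel L M β (trivialMultiplier L M) (klEffectiveAction L M β U μ (klFlowFrameU L M β U μ n) klE0 j) 4 τ' x'‖ ≤ S₄ j) →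
      (∀ j, d ≤ j → j ≤ n → ∀ (q : Fin 6) (τ' : Fin 6 → SectorLeg 1) (y' : SpaceTimeIdx L M),
        imagTimeWeight β M ^ 5 * ∑ x' ∈ univ.filter (fun x' : Fin 6 → SpaceTimeIdx L M => x' q = y'),
          klScaleWt L M β j ((univ.image x').image (fun x : SpaceTimeIdx L M => (((((2 * (x.1 : ℕ) : ℕ)) : ZMod (2 * (2 * M)))), x.2))) *
            ‖sectorisedKernel L M β (trivialMultiplier L M) (klEffectiveAction L M β U μ (klFlowFrameU L M β U μ n) klE0 j) 6 τ' x'‖ ≤ S₆ j) →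
      (∀ j, 1 ≤ j → j ≤ n → klThinCountC * sectorCount j * (CW₄ ^ 4 * S₄ j) ≤ klWtBudget P Qe U j 4) →
      (∀ j, d ≤ j → j ≤ n → klThinCount6C * (Fintype.card (SectorLeg (sectorCount j)) : ℝ) ^ 4 * (CW₆ ^ 6 * S₆ j) ≤ klWtBudget P Qe U j 6) →
      ∀ j, j ≤ n → KernelNormsWt4 L M (klWtBudget P Qe U j) β U μ (klFlowFrameU L M β U μ n) j) := by
  obtain ⟨C₁, C₂, Cκ, Cb, CJ, C₁r, C₂r, Cκr, Cbr, CJr, C₁i, C₂i, hC₁, hC₂, hCκ, hCb, hCJ, hC₁r, hC₂r, hCκr, hCbr, hCJr, hC₁i, hC₂i,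
    Cinc₁, Dinc₁, hCinc₁, hDinc₁, Cκ₀, CJ₀, Cα, hCκ₀, hCJ₀, hCα, Cκz, Cbz, CJz, hCκz, hCbz, hCJz, CWi, CW₄, CW₆, hCWi, hCW₄, hCW₆,
    Cinc₂, Dinc₂, hCinc₂, hDinc₂, Cκ₁, CJ₁, Cα₁, hCκ₁, hCJ₁, hCα₁, hall⟩ := kernelNormsWt4_all_klEng_closed_sharp3 d R c'' hc''
  refine ⟨C₁, C₂, Cκ, Cb, CJ, C₁r, C₂r, Cκr, Cbr, CJr, C₁i, C₂i, hC₁, hC₂, hCκ, hCb, hCJ, hC₁r, hC₂r, hCκr, hCbr, hCJr, hC₁i, hC₂i,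
    Cinc₁, Dinc₁, hCinc₁, hDinc₁, Cκ₀, CJ₀, Cα, hCκ₀, hCJ₀, hCα, Cκz, Cbz, CJz, hCκz, hCbz, hCJz, CWi, CW₄, CW₆, hCWi, hCW₄, hCW₆,
    Cinc₂, Dinc₂, hCinc₂, hDinc₂, Cκ₁, CJ₁, Cα₁, hCκ₁, hCJ₁, hCα₁, fun hR2 => ?_⟩
  obtain ⟨c₃a, hc₃a, U₀a, hU₀a, hall'⟩ := hall hR2
  refine ⟨c₃a, hc₃a, U₀a, hU₀a, fun P hP => ?_⟩
  obtain ⟨c₀, hc₀, U₁, hU₁, hall''⟩ := hall' P hP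
  obtain ⟨A₁, P₁, T₁, hA₁, hP₁, hT₁, c₀w, hc₀w, U₀w, hU₀w, hdatW⟩ := exists_levelZeroDatumWt_klEng P R hP hR2
  obtain ⟨A₁', P₁', T₁', hA₁', hP₁', hT₁', c₀p, hc₀p, U₀p, hU₀p, hdatP⟩ := exists_levelZeroDatum_klEng P R hP hR2
  refine ⟨A₁, P₁, T₁, A₁', P₁', T₁', hA₁, hP₁, hT₁, hA₁', hP₁', hT₁', min c₀ (min c₀w c₀p), lt_min hc₀ (lt_min hc₀w hc₀p),
    min U₁ (min U₀w U₀p), lt_min hU₁ (lt_min hU₀w hU₀p), ?_⟩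
  intro G Q c hc hc6 hc₃' hcc₀ μ hμ U hU hU9 hU₀' hUU₁ hcU β hβmin hβc L M _ _ hL3 hM3 n hn1 hnN hkl hhist hosc hd D hD3 hD hcard hD0
    B A Q' Ab Qb hB hA hQ hAb hQb Ab₀ Qb₀ hAb₀ hQb₀ αb₀ κb₀ crb₀ ccb₀ W₀ Z₀ σ₀ τ₀ ψ₀ Φ₀ hαb₀ hκb₀ hcrb₀ hccb₀ hW₀ hZ₀ hσ₀ hτ₀ hψ₀ hΦ₀
    A'₀ Q'₀ ι₁₀ ι₂₀ ι₃₀ hA'₀ hQ'₀ hdA₀ hdQ₀ hdι₀ ν₀ hν₀3 hν₀1 hν₀2 hblk0 Aro₁ Qro₁ Qtot₁ Atot₁ hAro₁ hQro₁ hQtot₁ hAtot₁ hAtotle hQtotQb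
    κz αz crz ccz hκz hαz hcrz hccz νz hνz1 hνz2 hνz3 hguardz
    αb₁ κb₁ crb₁ ccb₁ W₁ Z₁ σ₁ τ₁ ψ₁ Φ₁ hαb₁ hκb₁ hcrb₁ hccb₁ hW₁ hZ₁eq hσ₁ hτ₁ hψ₁ hΦ₁ A'₁ Q'₁ ι₁₁ ι₂₁ ι₃₁ hA'₁ hQ'₁
    hdA₁ hdQ₁ hdι₁ ν₁ hν₁3 hν₁1 hν₁2 hblk1 Aro₂ Qro₂ Qtot₂ Atot₂ hAro₂ hQro₂ hQtot₂ hAtot₂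
    κb αb crb ccb hκb hαb hcrb hccb hκbr hαbr hcrbr hccbr W Z σ τ ψ Φ hW hZ' hσ hτ hψ hΦ
    A' Q'' hA'1 hQ'1 hA'2 hQ'2 hQ'0 S₂ s₄ s₆ hS₂0 hs₄ hs₆ hS₂ hS₄ hS₆ i₁ ι₁ i₂ x₆ ι₂ ι₃ hi₁ hi₂ hx₆ hι₁ hι₂ hι₃ hnum
    Qe Atot Qtot hQtot hAtot hCE hCE₂ hQe S₄ S₆ hS₄0 hS₆0 hL4 hL6 hT4 hT6 j hjn
  -- the folded doors
  have hcc₀a : c ≤ c₀ := hcc₀.trans (min_le_left _ _)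
  have hcc₀w : c ≤ c₀w := hcc₀.trans ((min_le_right _ _).trans (min_le_left _ _))
  have hcc₀p : c ≤ c₀p := hcc₀.trans ((min_le_right _ _).trans (min_le_right _ _))
  have hUU₁a : U ≤ U₁ := hUU₁.trans (min_le_left _ _)
  have hUU₁w : U ≤ U₀w := hUU₁.trans ((min_le_right _ _).trans (min_le_left _ _))
  have hUU₁p : U ≤ U₀p := hUU₁.trans ((min_le_right _ _).trans (min_le_right _ _))
  have hβ : 0 < β := KLRegimeSplit.pos_of_klBetaMin_le hβmin
  have hK1 : 1 ≤ P.Klam := hP.1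
  have hKl : 0 ≤ P.Klam := le_trans zero_le_one hK1
  have hB0 : 0 ≤ B := zero_le_one.trans hB
  have hM0 : (0 : ℝ) < M := Nat.cast_pos.2 (Nat.pos_of_ne_zero (NeZero.ne M))
  have he0 : (0 : ℝ) < klE0 := by norm_num [klE0]
  have hεx : 0 < imagTimeWeight β M := imagTimeWeight_pos_of_pos (M := M) hβ
  have hε0 : ∀ i, 0 ≤ epsCoupling P U i := fun i => epsCoupling_nonneg' hKl U i
  have hfr : FrameOK R U (nScales β) μ (klFlowFrameU L M β U μ n) := frameOK_klFlowFrameU_of_histP_le hR2 hn1 le_rfl hnN hhist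
  set K : TrigPolyC4v := klFlowFrameU L M β U μ n with hKdef
  have hAb₀0 : 0 ≤ Ab₀ := by rw [hAb₀]; positivity
  have hQb₀0 : 0 ≤ Qb₀ := by rw [hQb₀]; positivity
  -- the level-0 WEIGHTED datum at every rate (W13)
  have hdat := fun jr => hdatW c hc hcc₀w μ hμ U hU hU9 hUU₁w β hβmin hβc L M hL3 hM3 K hfr jr
  have hlawb₀ : ∀ j j', 1 ≤ j → j ≤ n → ∀ p : ℕ, 3 ≤ p →
      klTowerMeasWtAt L M β U μ K 1 1 j (2 * p) / klLevUnitF β M 0 p 0 ≤ Ab₀ * (B * epsCoupling P U j') ^ (p - 1) * Qb₀ ^ p := by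
    intro j j' _ _ p hp; rw [hAb₀, hQb₀]; exact (hdat j).1 B hB j' p hp
  -- the kit rows of a block-0 name group from the unit law, the dominations and the majorant array (§1)
  have hkit : ∀ (Wg Zg σg τg Φg A'g Q'g i1 i2 i3 αg κg crg ccg CJg Cκg Cαg : ℝ) (νg : ℕ → ℝ) (jc : ℕ),
      αg = Cαg * ((M : ℝ) / β) → κg = Real.sqrt (2 * Cκg * klE0) → crg = 81 * CJg * M / β → ccg = 162 * CJg * M / β →
      Wg = 32 * crg / ccg → Zg = imagTimeWeight β M ^ 2 * ccg ^ 2 / 8 → τg = 4 * exp 4 * κg ^ 2 / ccg ^ 2 → Φg = exp 1 * αg * ccg / (κg ^ 2 * crg) →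
      0 < CJg → 0 < Cκg → 0 < Cαg →
      Wg * Ab₀ ≤ A'g → Zg * Qb₀ ≤ Q'g → Wg * Zg ^ 3 * Ab₀ * Qb₀ ^ 3 ≤ i3 →
      (∀ m, 3 ≤ m → Wg * Zg ^ m * (Ab₀ * (B * epsCoupling P U jc) ^ (m - 1) * Qb₀ ^ m) ≤ νg m) →
      Wg * Zg ^ 1 * (T₁ * (|U| + c) / imagTimeWeight β M) ≤ νg 1 →
      Wg * Zg ^ 2 * (A₁ * P₁ ^ 2 * |U| / imagTimeWeight β M ^ 3) ≤ νg 2 →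
      ∀ j, 1 ≤ j → j ≤ n → (Wg * Zg ^ 1 * (T₁ * (|U| + c) / imagTimeWeight β M) ≤ i1 * (B * epsCoupling P U jc) ∧
        Wg * Zg ^ 2 * (A₁ * P₁ ^ 2 * |U| / imagTimeWeight β M ^ 3) ≤ i2 * (B * epsCoupling P U jc) ∧
        4 * σg * (B * epsCoupling P U jc) * Q'g < 1 ∧ 2 * (B * epsCoupling P U jc) * τg * Q'g ≤ 1 ∧ exp 1 * τg * (B * epsCoupling P U jc) * Q'g < 1 ∧
        Φg * (τg * (i1 * (B * epsCoupling P U jc) + i2 / (2 * Q'g) + i3 / (4 * Q'g ^ 2) + A'g * Q'g / 4)) < 1 ∧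
        Φg * (exp 1 * τg * (i1 * (B * epsCoupling P U jc)) + (exp 1 * τg) ^ 2 * (i2 * (B * epsCoupling P U jc)) +
          (exp 1 * τg) ^ 3 * (i3 * (B * epsCoupling P U jc) ^ 2) +
          A'g * (exp 1 * τg * Q'g) * ((exp 1 * τg * (B * epsCoupling P U jc) * Q'g) ^ 3 / (1 - exp 1 * τg * (B * epsCoupling P U jc) * Q'g))) < 1 ∧
        Φg * towerV D τg νg < 1) →
      ((∀ m, 4 ≤ m → m ≤ D → Wg * Zg ^ m * (klTowerMeasWtAt L M β U μ K 1 1 j (2 * m) / klLevUnitF β M 0 m 0) ≤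
          A'g * (B * epsCoupling P U jc) ^ (m - 1) * Q'g ^ m) ∧
        Wg * Zg ^ 3 * (klTowerMeasWtAt L M β U μ K 1 1 j (2 * 3) / klLevUnitF β M 0 3 0) ≤ i3 * (B * epsCoupling P U jc) ^ 2 ∧
        Wg * Zg ^ 1 * (klTowerMeasWtAt L M β U μ K 1 1 j (2 * 1) / klLevUnitF β M 0 1 0) ≤ i1 * (B * epsCoupling P U jc) ∧
        Wg * Zg ^ 2 * (klTowerMeasWtAt L M β U μ K 1 1 j (2 * 2) / klLevUnitF β M 0 2 0) ≤ i2 * (B * epsCoupling P U jc) ∧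
        4 * σg * (B * epsCoupling P U jc) * Q'g < 1 ∧ 2 * (B * epsCoupling P U jc) * τg * Q'g ≤ 1 ∧ exp 1 * τg * (B * epsCoupling P U jc) * Q'g < 1 ∧
        Φg * (τg * (i1 * (B * epsCoupling P U jc) + i2 / (2 * Q'g) + i3 / (4 * Q'g ^ 2) + A'g * Q'g / 4)) < 1 ∧
        Φg * (exp 1 * τg * (i1 * (B * epsCoupling P U jc)) + (exp 1 * τg) ^ 2 * (i2 * (B * epsCoupling P U jc)) +
          (exp 1 * τg) ^ 3 * (i3 * (B * epsCoupling P U jc) ^ 2) +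
          A'g * (exp 1 * τg * Q'g) * ((exp 1 * τg * (B * epsCoupling P U jc) * Q'g) ^ 3 / (1 - exp 1 * τg * (B * epsCoupling P U jc) * Q'g))) < 1 ∧
        Φg * towerV D τg (fun m => Wg * Zg ^ m * (klTowerMeasWtAt L M β U μ K 1 1 j (2 * m) / klLevUnitF β M 0 m 0)) < 1) := by
    intro Wg Zg σg τg Φg A'g Q'g i1 i2 i3 αg κg crg ccg CJg Cκg Cαg νg jc hαg hκg hcrg hccg hWg hZg hτg hΦg hCJg hCκg hCαg hdA hdQ hdι hν3 hν1 hν2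
      j hj1 hjn hb
    obtain ⟨hi1, hi2, hx1, hx2, hx3, hy, hθ, hg⟩ := hb
    have hκg0 : 0 < κg := by rw [hκg]; exact Real.sqrt_pos.2 (by positivity)
    have hcrg0 : 0 < crg := by rw [hcrg]; positivity
    have hccg0 : 0 < ccg := by rw [hccg]; positivity
    have hWg0 : 0 ≤ Wg := by rw [hWg]; positivity
    have hZg0 : 0 ≤ Zg := by rw [hZg]; positivity
    have hτg0 : 0 ≤ τg := by rw [hτg]; positivity
    have hαg0 : 0 ≤ αg := by rw [hαg]; positivity
    have hΦg0 : 0 ≤ Φg := by rw [hΦg]; positivity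
    obtain ⟨h4, h3, h1, h2, hgd⟩ := kitRowsWt_of_unitLaw (D := D) (μ := fun m => klTowerMeasWtAt L M β U μ K 1 1 j (2 * m) / klLevUnitF β M 0 m 0)
      (ν := νg) hWg0 hZg0 hτg0 hΦg0 hAb₀0 hQb₀0 (mul_nonneg hB0 (hε0 jc)) (fun m hm => hlawb₀ j jc hj1 hjn m hm) (hdat j).2.1 (hdat j).2.2
      hdA hdQ hdι hi1 hi2 (fun m hm => hν3 m hm) hν1 hν2 hg
    exact ⟨h4, h3, h1, h2, hx1, hx2, hx3, hy, hθ, hgd⟩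
  -- the two block-0 bundles in kit currency
  have hblk0' := fun j (hjd : d ≤ j) (hjn : j ≤ n) =>
    hkit W₀ Z₀ σ₀ τ₀ Φ₀ A'₀ Q'₀ ι₁₀ ι₂₀ ι₃₀ αb₀ κb₀ crb₀ ccb₀ CJ₀ Cκ₀ Cα ν₀ d hαb₀ hκb₀ hcrb₀ hccb₀ hW₀ hZ₀ hτ₀ hΦ₀ hCJ₀ hCκ₀ hCα hdA₀ hdQ₀ hdι₀
      hν₀3 hν₀1 hν₀2 j (by omega) hjn (hblk0 (hjd.trans hjn))
  have hblk1' := fun j (hj1 : 1 ≤ j) (hjd : j ≤ d - 1) (hjn : j ≤ n) =>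
    hkit W₁ Z₁ σ₁ τ₁ Φ₁ A'₁ Q'₁ ι₁₁ ι₂₁ ι₃₁ αb₁ κb₁ crb₁ ccb₁ CJ₁ Cκ₁ Cα₁ (ν₁ j) j hαb₁ hκb₁ hcrb₁ hccb₁ hW₁ hZ₁eq hτ₁ hΦ₁ hCJ₁ hCκ₁ hCα₁ hdA₁ hdQ₁ hdι₁
      (fun m hm => hν₁3 j m hm) (hν₁1 j) (hν₁2 j) j hj1 hjn (hblk1 j hj1 hjd hjn)
  -- the Z-thread's PLAIN guard from p3's plain datum majorants (towerV monotone)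
  have hguardz' : d ≤ n → 9 * αz * ccz / ((27 : ℝ) ^ 5 * exp 1 * κz ^ 2 * crz) *
      towerV D (exp 2 * κz ^ 2 / ccz ^ 2)
        (fun m => 64 * (27 : ℝ) ^ 4 * exp 2 * crz / ccz * (exp 4 * ccz ^ 2 * imagTimeWeight β M ^ 2 / 8) ^ m *
          klTowerMuLevF L M β U μ K 1 1 m) < 1 := by
    intro hdn
    obtain ⟨-, hm1, hm2, hm3⟩ := hdatP c hc hcc₀p μ hμ U hU hU9 hUU₁p β hβmin hβc L M hL3 hM3 K hfr
    have hκz0 : 0 < κz := by rw [hκz]; exact Real.sqrt_pos.2 (by positivity)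
    have hcrz0 : 0 < crz := by rw [hcrz]; positivity
    have hccz0 : 0 < ccz := by rw [hccz]; positivity
    have hαz0 : 0 ≤ αz := by rw [hαz]; positivity
    refine lt_of_le_of_lt (mul_le_mul_of_nonneg_left (towerV_mono_Icc (by positivity) fun m hm1' _ => ?_) (by positivity)) (hguardz hdn)
    refine mul_le_mul_of_nonneg_left ?_ (by positivity)
    rcases Nat.lt_or_ge m 3 with hm | hm
    · interval_cases m
      · exact hm1.trans hνz1
      · exact hm2.trans hνz2
    · exact (hm3 B hB 1 m hm).trans (hνz3 m hm)
  exact hall'' G Q c hc hc6 hc₃' hcc₀a μ hμ U hU hU9 hU₀' hUU₁a hcU β hβmin hβc L M hL3 hM3 n hn1 hnN hkl hhist hosc hd D hD3 hD hcard hD0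
    B A Q' Ab Qb hB hA hQ hAb hQb Ab₀ Qb₀ hAb₀0 hQb₀0 αb₀ κb₀ crb₀ ccb₀ W₀ Z₀ σ₀ τ₀ ψ₀ Φ₀ hαb₀ hκb₀ hcrb₀ hccb₀ hW₀ hZ₀ hσ₀ hτ₀ hψ₀ hΦ₀
    A'₀ Q'₀ ι₁₀ ι₂₀ ι₃₀ hA'₀ hQ'₀ hlawb₀ hblk0' Aro₁ Qro₁ Qtot₁ Atot₁ hAro₁ hQro₁ hQtot₁ hAtot₁ hAtotle hQtotQb
    κz αz crz ccz hκz hαz hcrz hccz hguardz'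
    αb₁ κb₁ crb₁ ccb₁ W₁ Z₁ σ₁ τ₁ ψ₁ Φ₁ hαb₁ hκb₁ hcrb₁ hccb₁ hW₁ hZ₁eq hσ₁ hτ₁ hψ₁ hΦ₁ A'₁ Q'₁ ι₁₁ ι₂₁ ι₃₁ hA'₁ hQ'₁ hblk1'
    Aro₂ Qro₂ Qtot₂ Atot₂ hAro₂ hQro₂ hQtot₂ hAtot₂
    κb αb crb ccb hκb hαb hcrb hccb hκbr hαbr hcrbr hccbr W Z σ τ ψ Φ hW hZ' hσ hτ hψ hΦ
    A' Q'' hA'1 hQ'1 hA'2 hQ'2 hQ'0 S₂ s₄ s₆ hS₂0 hs₄ hs₆ hS₂ hS₄ hS₆ i₁ ι₁ i₂ x₆ ι₂ ι₃ hi₁ hi₂ hx₆ hι₁ hι₂ hι₃ hnum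
    Qe Atot Qtot hQtot hAtot hCE hCE₂ hQe S₄ S₆ hS₄0 hS₆0 hL4 hL6 hT4 hT6 j hjn

end Summit.HubbardSuperconductivity.HubbardSuperconductivity.Theorems.EngineV8

end
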